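import Summits.CriticalPhenomena.PercolationContinuityZ3.Theorems.PercNearOneGluingNoHeavyLowerTailE3RestrictedCertCheck
import Summits.CriticalPhenomena.PercolationContinuityZ3.Theorems.PercNearOneGluingNoHeavyLowerTailE3FourPointClassesAllGraphs
import Summits.CriticalPhenomena.PercolationContinuityZ3.Theorems.PercNearOneGluingNoHeavyLowerTailE3FourPointSplitGluing

/-!
# `NoHeavyLowerTail` (crux stmt-CriticalPhenomena-4575): the open four-point E3GRP class `γ` — Richards–Sahi
# `E₃(U[ab|cy], U[ac|by], U[ay|bc]) ≥ 0` — holds on every weighted graph with at most SIX vertices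

Support file (prover seat `prim-ineq-prove-1` gen 24; `--supports stmt-CriticalPhenomena-4575`; COMPUTATIONAL: the two restricted
three-copy checks and the relabelling cover use `native_decide`).  No definitions of mathematical content (only the two coordinate
lists of the split and the loop-free weight vector), no named facts, no sorries.

`γ` (`row4 6`, `GammaRow` of `…CoSunflowerRows`, the perfect-matching group-connection row, an instance of Kahn's Conjecture 5 /
Sahi's `C₃`) is the last of the seven four-point E3GRP classes that is open on general graphs; it was kernel-certified for `n ≤ 5`
(`fourPointClass_le_five`), while a three-copy replay on `K₆` (`4^15` fibre sums) is out of reach of the in-kernel check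
(prim-cert-2, FINDING-K6-THREECOPY-KERNEL-COST).  Here `n = 6` is obtained WITHOUT the `K₆` certificate:

1. **Split.**  With terminals `a b c y = 0 1 2 3` and Steiner vertices `4, 5`, the edge set of `K₆` is `D_K ⊔ D_H`, `D_K` = the six
   terminal pairs (coordinates `ιK6 = 0,1,2,5,6,9` of `allPairs 6`), `D_H` = the nine pairs at the Steiner vertices (`ιH6`); the two
   edge sets share only terminals, so by `FourPointSplit.sahiE3_fourPointSplit_nonneg_of_terminalGluing` (prim-sahi-p2: `γ` in product
   coordinates is multiplicative along a gluing of the four terminals, and the K3-semigroup theorem `IncTwin.tincH_join_nonneg`)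
   `γ` for a weight vector `w` follows from `γ` for `w·1_{D_K}` and for `w·1_{D_H}` (loops carry no information, `offDiagW`).
2. **Two restricted certificates.**  `w·1_{D_K}` and `w·1_{D_H}` are supported on 6 resp. 9 coordinates, so the restricted three-copy
   check of `…E3RestrictedCertCheck` applies: `checkSix_pieceK` (base `2^22`, `4^6` digits) and `checkSix_pieceH` (base `2^31`, `4^9`
   digits) return `true` — all tensor-Bernstein fibre sums of `γ` on the 9-edge graph `H = K_{2,4} + s₁s₂` are nonnegative integers
   (independently re-derived in exact arithmetic: 262144 coefficients, minimum 0, sum 4288512; memo prim-ineq-prove-1/G4-CENSUS §4).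
3. **All placements** by transport along vertex relabellings (`rowHolds4_forall_relabel`, `cover_quad6`), and `n ≤ 5` from
   `fourPointClass_le_five`.

Results: `fourPointGamma_le_six` (`Row4Holds 6`), `classGamma_le_six` (`E3Ineq` with `lnk`), `sahiE3_gamma_nonneg_le_six`
(`openConn` form), `gammaRow_le_six` (the `GammaRow` events on `Fin n`, `n ≤ 6`).  By the same gluing theorem the class of graphs
satisfying `γ` is closed under gluing along the four terminals, so `γ` also holds on every graph all of whose Steiner components have
at most two vertices once the pieces are transported to `Fin 6` (not done here).
[cite: LiebSahi2021, eq. (2.1) (the functional E₃)]; [cite: Kahn2022, Conj. 5 (arXiv p. 3)]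
-/

namespace Summit.CriticalPhenomena.PercolationContinuityZ3.Theorems.E3GroupSepCert

open Finset MeasureTheory OneCutCert CovTransferCert
open scoped BigOperators
open Literature.Probability.Percolation Literature.Probability.LatticeModels

variable {n : ℕ}

/-! ## Loops carry no information -/

/-- Probabilities of connectivity events only see the weights of the non-diagonal pairs. [folklore] -/
theorem pr_congr_offDiag {w w' : Sym2 (Fin n) → unitInterval} (h : ∀ i : Fin (mE n), w (edgeE n i) = w' (edgeE n i))
    (P : CRel n → Bool) : pr w P = pr w' P := by
  unfold pr
  rw [real_connEvent_eq_ML, real_connEvent_eq_ML]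
  have hx : xOf w = xOf w' := funext fun i => by unfold xOf; rw [h i]
  rw [hx]

/-- `E3Ineq` only sees the weights of the non-diagonal pairs. [folklore] -/
theorem e3Ineq_congr_offDiag {w w' : Sym2 (Fin n) → unitInterval} (h : ∀ i : Fin (mE n), w (edgeE n i) = w' (edgeE n i))
    (A B C : CRel n → Bool) : E3Ineq w A B C ↔ E3Ineq w' A B C := by
  have e : ∀ P : CRel n → Bool, (prodBernoulli w).real (connEvent P) = (prodBernoulli w').real (connEvent P) :=
    fun P => pr_congr_offDiag h P
  unfold E3Ineq
  simp only [← connEvent_pAnd, e]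

/-- The weight vector with all loops (diagonal pairs) switched off. [this work] -/
def offDiagW (w : Sym2 (Fin n) → unitInterval) : Sym2 (Fin n) → unitInterval := fun e => if e.IsDiag then 0 else w e

/-- `offDiagW w` agrees with `w` on the coordinate pairs. [this work] -/
theorem offDiagW_edgeE (w : Sym2 (Fin n) → unitInterval) (i : Fin (mE n)) : offDiagW w (edgeE n i) = w (edgeE n i) := by
  unfold offDiagW
  rw [if_neg ((mem_range_edgeE _).1 ⟨i, rfl⟩)]

/-- `offDiagW w` vanishes on loops. [this work] -/
theorem offDiagW_of_isDiag (w : Sym2 (Fin n) → unitInterval) {e : Sym2 (Fin n)} (he : e.IsDiag) : offDiagW w e = 0 := by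
  unfold offDiagW
  rw [if_pos he]

/-- A four-point row for `offDiagW w` is the row for `w`. [this work] -/
theorem rowHolds4_offDiagW_iff (i : Fin 7) (w : Sym2 (Fin n) → unitInterval) (t : Quad n) :
    Row4Holds i (offDiagW w) t ↔ Row4Holds i w t :=
  e3Ineq_congr_offDiag (fun j => offDiagW_edgeE w j) _ _ _

/-! ## The split of `K₆`: terminal pairs and Steiner pairs -/

/-- `K₆` has fifteen coordinate pairs. [this work] -/
theorem mE_six : mE 6 = 15 := by decide

/-- Coordinates of the six TERMINAL pairs `(0,1),(0,2),(0,3),(1,2),(1,3),(2,3)` in `allPairs 6`. [this work] -/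
def ιK6 : Fin 6 → Fin (mE 6) := fun t => Fin.cast mE_six.symm ((![0, 1, 2, 5, 6, 9] : Fin 6 → Fin 15) t)

/-- Coordinates of the nine pairs at the STEINER vertices `4, 5` (the graph `H = K_{2,4} + s₁s₂`). [this work] -/
def ιH6 : Fin 9 → Fin (mE 6) := fun t => Fin.cast mE_six.symm ((![3, 4, 7, 8, 10, 11, 12, 13, 14] : Fin 9 → Fin 15) t)

/-- `ιK6` is injective. [this work] -/
theorem ιK6_injective : Function.Injective ιK6 := by decide

/-- `ιH6` is injective. [this work] -/
theorem ιH6_injective : Function.Injective ιH6 := by decide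

/-- The two coordinate sets are disjoint. [this work] -/
theorem ιK6_ne_ιH6 : ∀ t t', ιK6 t ≠ ιH6 t' := by decide

/-- The two coordinate sets cover all fifteen pairs. [this work] -/
theorem ι6_cover : ∀ i : Fin (mE 6), (∃ t, ιK6 t = i) ∨ (∃ t, ιH6 t = i) := by decide

/-- The terminal pairs only contain terminals. [this work] -/
theorem ιK6_terminal : ∀ t : Fin 6, ∀ v : Fin 6, v ∈ edgeE 6 (ιK6 t) → (v = 0 ∨ v = 1 ∨ v = 2 ∨ v = 3) := by decide

/-- The terminal edge set `D_K`. [this work] -/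
def DK6 : Finset (Sym2 (Fin 6)) := Finset.univ.image fun t => edgeE 6 (ιK6 t)

/-- The Steiner edge set `D_H`. [this work] -/
def DH6 : Finset (Sym2 (Fin 6)) := Finset.univ.image fun t => edgeE 6 (ιH6 t)

/-- `D_K` and `D_H` are disjoint. [this work] -/
theorem disjoint_DK6_DH6 : Disjoint DK6 DH6 := by
  rw [Finset.disjoint_left]
  intro e he he'
  obtain ⟨t, -, rfl⟩ := Finset.mem_image.1 he
  obtain ⟨t', -, h⟩ := Finset.mem_image.1 he'
  exact ιK6_ne_ιH6 t t' (edgeE_injective 6 h).symm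

/-- Edges of `D_K` and `D_H` share only terminals (indeed every vertex of a `D_K` edge is a terminal). [this work] -/
theorem sep_DK6_DH6 : ∀ v : Fin 6, ∀ e₁ ∈ DK6, ∀ e₂ ∈ DH6, v ∈ e₁ → v ∈ e₂ →
    (v = (0 : Fin 6) ∨ v = (1 : Fin 6) ∨ v = (2 : Fin 6) ∨ v = (3 : Fin 6)) := by
  intro v e₁ he₁ e₂ _ hv _
  obtain ⟨t, -, rfl⟩ := Finset.mem_image.1 he₁
  exact ιK6_terminal t v hv

/-- `offDiagW w` is supported on `D_K ∪ D_H`. [this work] -/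
theorem offDiagW_support6 (w : Sym2 (Fin 6) → unitInterval) : ∀ e, e ∉ DK6 ∪ DH6 → offDiagW w e = 0 := by
  intro e he
  by_cases hd : e.IsDiag
  · exact offDiagW_of_isDiag w hd
  · exfalso
    obtain ⟨i, rfl⟩ := (mem_range_edgeE e).2 hd
    apply he
    rw [Finset.mem_union]
    rcases ι6_cover i with ⟨t, ht⟩ | ⟨t, ht⟩
    · exact Or.inl (Finset.mem_image.2 ⟨t, Finset.mem_univ _, by rw [ht]⟩)
    · exact Or.inr (Finset.mem_image.2 ⟨t, Finset.mem_univ _, by rw [ht]⟩)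

/-! ## The two restricted three-copy certificates (COMPUTATIONAL) -/

/-- **The terminal piece**: the restricted three-copy check of `γ` along `ιK6` passes (base `2^22`, `4^6` digits). [this work] -/
theorem checkSix_pieceK : checkE3R 6 ιK6 22 (row4 6 (quad₀ 6 (by norm_num))).1 (row4 6 (quad₀ 6 (by norm_num))).2.1
    (row4 6 (quad₀ 6 (by norm_num))).2.2 = true := by
  native_decide

/-- **The Steiner piece `H = K_{2,4} + s₁s₂`**: the restricted three-copy check of `γ` along `ιH6` passes (base `2^31`, `4^9`
digits: all 262144 tensor-Bernstein fibre sums of `γ` on `H` are nonnegative). [this work] -/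
theorem checkSix_pieceH : checkE3R 6 ιH6 31 (row4 6 (quad₀ 6 (by norm_num))).1 (row4 6 (quad₀ 6 (by norm_num))).2.1
    (row4 6 (quad₀ 6 (by norm_num))).2.2 = true := by
  native_decide

/-! ## Gluing the two pieces -/

/-- The standard quadruple of `Fin 6` is `(0, 1, 2, 3)`. [this work] -/
theorem quad₀_six : quad₀ 6 (by norm_num) = ((0 : Fin 6), (1 : Fin 6), (2 : Fin 6), (3 : Fin 6)) := rfl

/-- **`γ` at the standard quadruple of `K₆`, every weight vector** — by the four-terminal gluing theorem applied to the two certified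
pieces. [this work] -/
theorem rowSix_quad₀_six (w : Sym2 (Fin 6) → unitInterval) : Row4Holds 6 w (quad₀ 6 (by norm_num)) := by
  rw [← rowHolds4_offDiagW_iff, quad₀_six, rowHolds4_six_iff]
  refine FourPointSplit.sahiE3_fourPointSplit_nonneg_of_terminalGluing (offDiagW w) disjoint_DK6_DH6 sep_DK6_DH6
    (offDiagW_support6 w) ?_ ?_
  · rw [← rowHolds4_six_iff, ← quad₀_six]
    refine e3_of_checkE3R ιK6_injective checkSix_pieceK _ fun i hi => ?_
    show (if edgeE 6 i ∈ DK6 then offDiagW w (edgeE 6 i) else 0) = 0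
    rw [if_neg]
    intro hmem
    obtain ⟨t, -, ht⟩ := Finset.mem_image.1 hmem
    exact hi ⟨t, edgeE_injective 6 ht⟩
  · rw [← rowHolds4_six_iff, ← quad₀_six]
    refine e3_of_checkE3R ιH6_injective checkSix_pieceH _ fun i hi => ?_
    show (if edgeE 6 i ∈ DH6 then offDiagW w (edgeE 6 i) else 0) = 0
    rw [if_neg]
    intro hmem
    obtain ⟨t, -, ht⟩ := Finset.mem_image.1 hmem
    exact hi ⟨t, edgeE_injective 6 ht⟩

/-! ## All placements, and `n ≤ 6` -/

/-- Cover of the distinct quadruples of `Fin 6` by relabellings of the standard one. [this work] -/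
theorem cover_quad6 : ∀ t ∈ distinctQuad 6, ∃ σ : Equiv.Perm (Fin 6), quadmap σ (quad₀ 6 (by norm_num)) = t := by
  native_decide

/-- **Class `γ` on `Fin 6`**, every weight vector and every distinct quadruple. [this work] -/
theorem rowHolds4_six_six (w : Sym2 (Fin 6) → unitInterval) (a b c y : Fin 6) (hab : a ≠ b) (hac : a ≠ c) (hay : a ≠ y)
    (hbc : b ≠ c) (hby : b ≠ y) (hcy : c ≠ y) : Row4Holds 6 w (a, b, c, y) := by
  obtain ⟨σ, hσ⟩ := cover_quad6 _ (mem_distinctQuad hab hac hay hbc hby hcy)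
  rw [← hσ]
  exact rowHolds4_forall_relabel 6 σ rowSix_quad₀_six w

/-- **The four-point E3GRP class `γ` holds on every weighted graph with at most six vertices**: for every `n ≤ 6`, every
`w : Sym2 (Fin n) → [0,1]` and all pairwise distinct `a b c y`, `E₃(U[ab|cy], U[ac|by], U[ay|bc]) ≥ 0` (`Row4Holds 6`) — the `K₆`
case by the four-terminal split `K₄ ⊔ H` and two restricted three-copy certificates, `n ≤ 5` by `fourPointClass_le_five`. [this work] -/
theorem fourPointGamma_le_six : ∀ n ≤ 6, ∀ (w : Sym2 (Fin n) → unitInterval) (a b c y : Fin n), a ≠ b → a ≠ c → a ≠ y →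
    b ≠ c → b ≠ y → c ≠ y → Row4Holds 6 w (a, b, c, y) := by
  intro n hn w a b c y hab hac hay hbc hby hcy
  rcases Nat.lt_or_eq_of_le hn with h | rfl
  · exact fourPointClass_le_five 6 n (by omega) w a b c y hab hac hay hbc hby hcy
  · exact rowHolds4_six_six w a b c y hab hac hay hbc hby hcy

/-- **Class `γ` on at most six vertices**, spelled out: `E₃(U[ab|cy], U[ac|by], U[ay|bc]) ≥ 0` as the inequality `E3Ineq` between
products of probabilities of the group links. [this work] -/
theorem classGamma_le_six : ∀ n ≤ 6, ∀ (w : Sym2 (Fin n) → unitInterval) (a b c y : Fin n), a ≠ b → a ≠ c → a ≠ y → b ≠ c →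
    b ≠ y → c ≠ y → E3Ineq w (lnk [a, b] [c, y]) (lnk [a, c] [b, y]) (lnk [a, y] [b, c]) :=
  fun n hn w a b c y hab hac hay hbc hby hcy => fourPointGamma_le_six n hn w a b c y hab hac hay hbc hby hcy

/-- **Class `γ` on at most six vertices, `openConn` form**: `0 ≤ E₃(lnk[ab|cy], lnk[ac|by], lnk[ay|bc])` for Sahi's `E₃` of the
product measure, the links written as unions of two-point connections. [this work] -/
theorem sahiE3_gamma_nonneg_le_six : ∀ n ≤ 6, ∀ (w : Sym2 (Fin n) → unitInterval) (a b c y : Fin n), a ≠ b → a ≠ c → a ≠ y →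
    b ≠ c → b ≠ y → c ≠ y →
    0 ≤ sahiE3 (prodBernoulli w) (openConn a c ∪ openConn a y ∪ openConn b c ∪ openConn b y)
        (openConn a b ∪ openConn a y ∪ openConn b c ∪ openConn c y)
        (openConn a b ∪ openConn a c ∪ openConn b y ∪ openConn c y) :=
  fun n hn w a b c y hab hac hay hbc hby hcy =>
    (rowHolds4_six_iff w a b c y).1 (fourPointGamma_le_six n hn w a b c y hab hac hay hbc hby hcy)

/-- **`GammaRow` (`…CoSunflowerRows`) on `Fin n` for `n ≤ 6`**: `0 ≤ E₃(lnk[ab|cy], lnk[ac|by], lnk[ay|bc])` with the group links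
written exactly as in the registered conjecture `GammaRow`, for all pairwise distinct terminals. [this work] -/
theorem gammaRow_le_six : ∀ n ≤ 6, ∀ (w : Sym2 (Fin n) → unitInterval) (a b c y : Fin n), a ≠ b → a ≠ c → a ≠ y →
    b ≠ c → b ≠ y → c ≠ y →
    0 ≤ sahiE3 (prodBernoulli w)
      {ω : BondConfig (Fin n) | ∃ x ∈ ({a, b} : Set (Fin n)), ∃ z ∈ ({c, y} : Set (Fin n)), (openGraph ω).Reachable x z}
      {ω : BondConfig (Fin n) | ∃ x ∈ ({a, c} : Set (Fin n)), ∃ z ∈ ({b, y} : Set (Fin n)), (openGraph ω).Reachable x z}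
      {ω : BondConfig (Fin n) | ∃ x ∈ ({a, y} : Set (Fin n)), ∃ z ∈ ({b, c} : Set (Fin n)), (openGraph ω).Reachable x z} := by
  intro n hn w a b c y hab hac hay hbc hby hcy
  have h := (e3Ineq_iff_sahiE3_nonneg w _ _ _).1 (classGamma_le_six n hn w a b c y hab hac hay hbc hby hcy)
  have e1 : {ω : BondConfig (Fin n) | ∃ x ∈ ({a, b} : Set (Fin n)), ∃ z ∈ ({c, y} : Set (Fin n)),
      (openGraph ω).Reachable x z} = connEvent (lnk [a, b] [c, y]) := by
    rw [connEvent_lnk]; ext ω; simp only [Set.mem_setOf_eq, Set.mem_insert_iff, Set.mem_singleton_iff, List.mem_cons,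
      List.not_mem_nil, or_false]; rfl
  have e2 : {ω : BondConfig (Fin n) | ∃ x ∈ ({a, c} : Set (Fin n)), ∃ z ∈ ({b, y} : Set (Fin n)),
      (openGraph ω).Reachable x z} = connEvent (lnk [a, c] [b, y]) := by
    rw [connEvent_lnk]; ext ω; simp only [Set.mem_setOf_eq, Set.mem_insert_iff, Set.mem_singleton_iff, List.mem_cons,
      List.not_mem_nil, or_false]; rfl
  have e3 : {ω : BondConfig (Fin n) | ∃ x ∈ ({a, y} : Set (Fin n)), ∃ z ∈ ({b, c} : Set (Fin n)),
      (openGraph ω).Reachable x z} = connEvent (lnk [a, y] [b, c]) := by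
    rw [connEvent_lnk]; ext ω; simp only [Set.mem_setOf_eq, Set.mem_insert_iff, Set.mem_singleton_iff, List.mem_cons,
      List.not_mem_nil, or_false]; rfl
  rw [e1, e2, e3]
  exact h

end Summit.CriticalPhenomena.PercolationContinuityZ3.Theorems.E3GroupSepCert
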